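import Summits.QuantumFields.BalabanUV.T4Continuum.Support.GradedWellData
import Summits.QuantumFields.BalabanUV.T4Continuum.Support.GradedSubBlocksRefine

/-!
# T⁴ programme, spine node NE2 (U1a), sub-row Δ1 — graded well, crew socket (GW-W1), file 2 of 4:
# THE UNIT DICTIONARY — scale-`n` anchors of the level torus ARE the unit blocks; B5's `Q′ = QsOp`, `Q = QvOp` ARE the owner's
# `meanS`/`avgS` at scale `s = n` (row bijection `Anc (fine n M) n ≃ Tor M`), and `‖Q A‖² = Σ_{Z, μ} |(Q_n A)(Z, μ)|²`

NE2 formalisation swarm `b2b-balaban-t4-ne2-formalise-*`, leaf 09 (gen 11), for the owner's socket (GW-W1) (R47 (e)/R48 (c)/R49 (a),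
journal 2026-08-21).  The owner's `GradedSubBlocks` types the scale-`s` averagings with rows indexed by ANCHORS of ONE torus and records
«`B5Block118.QsOp`/`QvOp` at `s = n` up to the row bijection `Tor M ≃ Anc`»; the two ends of the (GW-W1) transfer are typed on the two
sides of that bijection — file 1 (`GradedWellUnitSlice.exists_unit_gauge`) with B5's `QsOp`/`QvOp` (it rests on B5 (1.90)), leaf-07-g11's
«GW-V» (`GradedWellUnitMass`, graded vector mass dominates the unit mass) and file 3 (graded mean correction) with `meanS`/`avgS` at scale
`n`.  This file is the bijection, [folklore] bookkeeping (0 sorry):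

 * §1 `anchor_eq_bpt` (a scale-`n` anchor is the base point `n·y` of its unit block), `site_anchor_eq_bpt` (`Z + j = n·y + j`),
   **`blockOf_anchor_bijective`** (`Z ↦ blockOf Z` is a bijection `Anc (fine n M) n → Tor M`, inverse `y ↦ n·y`);
 * §2 **`meanS_eq_QsOp`**: `(Q′_n f)(Z) = (QsOp f)(blockOf Z)`; **`avgS_eq_QvOp`**: `(Q_n A)(Z, μ) = (QvOp A)(blockOf Z, μ)`;
   `meanS_eq_zero_of_QsOp` (`QsOp f = 0 →` every scale-`n` mean vanishes); **`nsq_QvOp_eq_sum_avgS`**: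
   `nsq (QvOp A) = Σ_{Z : Anc n} Σ_μ ‖(avgS n A)(Z, μ)‖²` (the left side of leaf-07-g11's `unitMass_le_nsq_QvGW`, read on B5's rows).

HONEST FRAMING (T4-DAG p. 1).  [folklore] finite-torus bookkeeping at model level (`U = 1`, finite torus); no estimate; NE2 (U1a) NOT proved;
spine PROVED 0/9 unchanged; NOT [B9] (3.16)/(3.23)–(3.27) as printed; NOT infinite volume / mass gap / Clay.  HONEST DEPENDENCY: continuum
YM on T⁴ ⇐ BetaPertH ∧ nine spine estimates (0/9 proved); BetaPertH ⇐ (D1) ∧ (D4) ∧ CAP+tail; G-an2-4 gates asym, D1 and NE2/3/4.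
ABSOLUTE RULE kept: no `def … : Prop` fact, no cited hypothesis, zero `sorry`.
-/

noncomputable section

open scoped BigOperators ComplexConjugate Matrix
open Finset

namespace Summit.QuantumFields.BalabanUV.T4Continuum.GradedWellUnitDict

open Literature.MathematicalPhysics.QuantumFieldTheory.Balaban1983to89.B5Prop11Plancherel (Tor fine)
open Literature.MathematicalPhysics.QuantumFieldTheory.Balaban1983to89.B5Prop11Lower (nsq)
open Literature.MathematicalPhysics.QuantumFieldTheory.Balaban1983to89.B5Block118 (tstep bpt QsOp QvOp QsOp_mulVec QvOp_mulVec lineSum)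
open Literature.MathematicalPhysics.QuantumFieldTheory.Balaban1983to89.B5Blocks16 (blockOf blockOf_bpt bpt_val bpt_eq_natCast)
open Summit.QuantumFields.BalabanUV.T4Continuum
open Summit.QuantumFields.BalabanUV.T4Continuum.ScalarPlantingDefect (val_blockOf)
open Summit.QuantumFields.BalabanUV.T4Continuum.GradedSubBlocks (Anchor Anc InSub site meanS avgS s_pos meanS_mulVec avgS_mulVec)

variable {d : ℕ} (n : ℕ) [NeZero n] (M : Fin d → ℕ) [hM : ∀ μ, NeZero (M μ)]

/-! ## §1 Scale-`n` anchors are the unit blocks -/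

omit [NeZero n] hM in
/-- every period is a multiple of the unit scale: `n ∣ n·M_ν`. [folklore] -/
theorem dvd_fine (ν : Fin d) : n ∣ fine n M ν := Dvd.intro _ rfl

/-- **A SCALE-`n` ANCHOR IS THE BASE POINT OF ITS UNIT BLOCK**: `Z = n·(blockOf Z) + 0`. [cite: Balaban1984PropagatorsI, (1.6) p.18 (shape)] [folklore] -/
theorem anchor_eq_bpt (Z : Anc (fine n M) n) : Z.1 = bpt n M (blockOf n M Z.1) (fun _ => (0 : Fin n)) := by
  funext ν
  apply ZMod.val_injective
  rw [bpt_val, val_blockOf]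
  obtain ⟨q, hq⟩ := Z.2 ν
  rw [hq, Nat.mul_div_cancel_left _ (s_pos n)]
  simp

/-- `Z + j = n·(blockOf Z) + j`: the offset parametrisation of the sub-block of a scale-`n` anchor IS B5's digit chart of its unit block.
[cite: Balaban1984PropagatorsI, (1.6) p.18 (shape)] [folklore] -/
theorem site_anchor_eq_bpt (Z : Anc (fine n M) n) (j : Fin d → Fin n) : site (fine n M) n Z.1 j = bpt n M (blockOf n M Z.1) j := by
  funext ν
  have h0 := congrFun (anchor_eq_bpt n M Z) ν
  simp only [site]
  rw [h0, bpt_eq_natCast, bpt_eq_natCast]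
  push_cast
  simp

/-- the base point of a unit block is a scale-`n` anchor. [folklore] -/
theorem anchor_bpt_zero (y : Tor M) : Anchor (fine n M) n (bpt n M y (fun _ => (0 : Fin n))) := by
  intro ν
  rw [bpt_val]
  simp

/-- **THE ROW BIJECTION**: `Z ↦ blockOf Z` is a bijection `Anc (fine n M) n → Tor M` (inverse `y ↦ n·y`). [folklore] -/
theorem blockOf_anchor_bijective : Function.Bijective (fun Z : Anc (fine n M) n => blockOf n M Z.1) := by
  constructor
  · intro Z W h
    apply Subtype.ext
    rw [anchor_eq_bpt n M Z, anchor_eq_bpt n M W]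
    exact congrArg (fun y => bpt n M y (fun _ => (0 : Fin n))) h
  · intro y
    exact ⟨⟨bpt n M y (fun _ => (0 : Fin n)), anchor_bpt_zero n M y⟩, blockOf_bpt n M y _⟩

/-! ## §2 B5's unit averagings are the scale-`n` averagings -/

/-- **`(Q′_n f)(Z) = (QsOp f)(blockOf Z)`**. [cite: Balaban1984PropagatorsI, (1.14)/(1.20) pp.19–20 (shape)] [folklore] -/
theorem meanS_eq_QsOp (f : Tor (fine n M) → ℂ) (Z : Anc (fine n M) n) :
    (meanS (fine n M) n *ᵥ f) Z = (QsOp n M *ᵥ f) (blockOf n M Z.1) := by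
  rw [meanS_mulVec (fine n M) n (dvd_fine n M) Z f, QsOp_mulVec]
  simp_rw [site_anchor_eq_bpt n M Z]
  rw [one_div]

/-- **`(Q_n A)(Z, μ) = (QvOp A)(blockOf Z, μ)`** ((1.18) at scale `n`). [cite: Balaban1984PropagatorsI, (1.18) p.20 (shape)] [folklore] -/
theorem avgS_eq_QvOp (A : Tor (fine n M) × Fin d → ℂ) (Z : Anc (fine n M) n) (μ : Fin d) :
    (avgS (fine n M) n *ᵥ A) (Z, μ) = (QvOp n M *ᵥ A) (blockOf n M Z.1, μ) := by
  rw [avgS_mulVec (fine n M) n (dvd_fine n M) A Z μ, QvOp_mulVec]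
  simp only [lineSum]
  simp_rw [site_anchor_eq_bpt n M Z]
  rw [one_div]

/-- `QsOp f = 0 →` every scale-`n` mean of `f` vanishes. [folklore] -/
theorem meanS_eq_zero_of_QsOp (f : Tor (fine n M) → ℂ) (h : QsOp n M *ᵥ f = 0) (Z : Anc (fine n M) n) :
    (meanS (fine n M) n *ᵥ f) Z = 0 := by
  rw [meanS_eq_QsOp, h, Pi.zero_apply]

/-- **`nsq (QvOp A) = Σ_{Z : Anc n} Σ_μ ‖(Q_n A)(Z, μ)‖²`** — B5's unit vector mass read on the owner's anchor rows (the left side of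
leaf-07-g11's «GW-V» `unitMass_le_nsq_QvGW`). [folklore] -/
theorem nsq_QvOp_eq_sum_avgS (A : Tor (fine n M) × Fin d → ℂ) :
    nsq (QvOp n M *ᵥ A) = ∑ Z : Anc (fine n M) n, ∑ μ : Fin d, ‖(avgS (fine n M) n *ᵥ A) (Z, μ)‖ ^ 2 := by
  unfold nsq
  rw [Fintype.sum_prod_type]
  refine (Fintype.sum_bijective _ (blockOf_anchor_bijective n M) _ _ fun Z => ?_).symm
  refine Finset.sum_congr rfl fun μ _ => ?_
  rw [avgS_eq_QvOp]

end Summit.QuantumFields.BalabanUV.T4Continuum.GradedWellUnitDict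

end
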